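import Summits.BirchSwinnertonDyer.BirchSwinnertonDyer.Theorems.BiquadraticEisensteinDescentEisensteinHeartFlatCMInertBadKPrimeKatzHsiehLValue
import Summits.BirchSwinnertonDyer.BirchSwinnertonDyer.Theorems.BiquadraticEisensteinDescentEisensteinHeartFlatCMInertBadKPrimeDeuringOverKPrimeRamification
import HarnessLib

set_option linter.dupNamespace false -- `Summit.BirchSwinnertonDyer.BirchSwinnertonDyer.Theorems.…` (summit = sub)
set_option autoImplicit false

/-!
# Crux `EisensteinHeartFlatCMInertBadKPrime` (stmt-BirchSwinnertonDyer-21341), line `hsieh-lambda`, layer 2 (V2):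
# hypothesis (L) with the biquadratic side conditions replaced by data on the CM field `K₁` alone

Route `BiquadraticEisensteinDescent` (cell `pub/bsd-wall`, width seat `bsd-wall-cm-bed-w3`). THEOREMS ONLY (no definition, no named
fact, no `sorry`); supports stmt-BirchSwinnertonDyer-21341 as a helper; nothing about the crux's input or any case of BSD is asserted.

`hLval_of_deuring_of_cmField` = `…KatzHsiehLValue.hLval_of_deuring` with its two field-theoretic side conditions `hdeg` ("no residue degree
4") and `hramL` ("`L/K′` ramifies only above bad primes") discharged by `…DeuringOverKPrimeResidueDegree.absNorm_eq_minFac_of_inertiaDeg_eq_two`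
and `…DeuringOverKPrimeRamification.not_hasGoodReductionAtPrime_of_ramificationIdx_eq_two` from an element `θ₀ ∈ 𝓞 K₁` and `a ∈ ℤ` with
`c • θ₀ = a − θ₀` (`θ₀ = (1+√d_CM)/2`, `a = 1`, or `θ₀ = √d_CM / 2`, `a = 0` for `d_CM = −4, −8`) such that `a − 2θ₀` (`= ∓√d_CM`) lies in no
prime of `K₁` of residue degree `2` and every rational prime below a prime of `K₁` containing it is bad for `W`. So the (L) binder of the
Katz–Hsieh socket is reduced to: the socket's (T), Deuring's clauses (i),(iv) for `ψ`, `η` ramified above the bad primes (= the socket's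
`hramS` content), the newform and CM hypotheses of the crux, the quadratic data (`[K:ℚ] = [K₁:ℚ] = [L:K] = [L:K₁] = 2`, `τ`, `(τ|ℚ)|K₁ = c`),
`ν = ‖·‖`, and the two K₁-element statements.

References: [SilvermanATAEC1994] Ch. II Thm. 10.5 (b), Ex. 2.30–2.32, App. A §3; [Hsieh2014mu] Prop. 4.9 (§4.8); [NeukirchANT1999] Ch. I §9.
-/

noncomputable section

open scoped NumberField
open NumberField IsDedekindDomain Complex CongruenceSubgroup WeierstrassCurve
open Literature.NumberTheory.GaloisRepresentations Literature.NumberTheory.EllipticCurves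
open Literature.NumberTheory.EllipticCurves.ModularForms
open Summit.BirchSwinnertonDyer.BirchSwinnertonDyer.Theorems.BiquadraticEisensteinDescentEisensteinHeartFlatCMInertBadKPrimeKatzHsiehLValue
open Summit.BirchSwinnertonDyer.BirchSwinnertonDyer.Theorems.BiquadraticEisensteinDescentEisensteinHeartFlatCMInertBadKPrimeDeuringOverKPrimeResidueDegree
open Summit.BirchSwinnertonDyer.BirchSwinnertonDyer.Theorems.BiquadraticEisensteinDescentEisensteinHeartFlatCMInertBadKPrimeDeuringOverKPrimeRamification

namespace Summit.BirchSwinnertonDyer.BirchSwinnertonDyer.Theorems.BiquadraticEisensteinDescentEisensteinHeartFlatCMInertBadKPrimeKatzHsiehLValueCM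

variable {K₁ K L : Type} [Field K₁] [NumberField K₁] [Field K] [NumberField K] [Field L] [NumberField L]
  [Algebra K₁ L] [IsGalois K₁ L] [Algebra K L] [IsGalois K L]

/-- **HYPOTHESIS (L) OF THE KATZ–HSIEH SOCKET from Deuring over `ℚ`, the socket's (T), and CM-field data only.** See the module
docstring; conclusion = the `hLval` binder of `…KatzHsiehDisplay.exists_span_C_mul_eq` for `lam := ψ.compRelNorm L * ν`, `cL = cL' = 1`.
[cite: SilvermanATAEC1994, Ch. II Thm. 10.5 (b) and Ex. 2.30–2.32 (pp. 171–179)] [cite: Hsieh2014mu, Prop. 4.9 (§4.8)]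
[cite: NeukirchANT1999, Ch. I §9 (9.4)–(9.6)] -/
theorem hLval_of_deuring_of_cmField [IsTotallyComplex L] [IsCMField L] [IsTotallyComplex K] [IsTotallyComplex K₁] [IsGalois ℚ K₁]
    {p : ℕ} [Fact p.Prime] {ι : PadicAlgCl p ≃+* ℂ} {Sp : Finset (HeightOneSpectrum (𝓞 L))} (hSp : KatzCM.IsPAdicCMType p Sp)
    (W : WeierstrassCurve ℚ) [W.IsElliptic] [W.IsGloballyMinimal] [NeZero (W.conductorNorm ℤ)] (hCM : W.HasCM)
    (c : K₁ ≃ₐ[ℚ] K₁) {ψ : HeckeCharacter K₁} (hψ1 : ψ.HasInfinityType (fun _ ↦ 1) (fun _ ↦ 0))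
    (hψgood : ∀ (ℓ : ℕ) [Fact ℓ.Prime], W.HasGoodReductionAtPrime ℓ →
      ∀ 𝔮 : HeightOneSpectrum (𝓞 K₁), (ℓ : 𝓞 K₁) ∈ 𝔮.asIdeal →
        ψ.IsUnramifiedAt 𝔮 ∧
        (c • 𝔮 ≠ 𝔮 →
          ψ.valueAtUniformizer 𝔮 + ψ.valueAtUniformizer (c • 𝔮) = (W.frobeniusTrace ℓ : ℂ) ∧
          ψ.valueAtUniformizer 𝔮 * ψ.valueAtUniformizer (c • 𝔮) = (ℓ : ℂ)) ∧
        (c • 𝔮 = 𝔮 → W.frobeniusTrace ℓ = 0 ∧ ψ.valueAtUniformizer 𝔮 = -(ℓ : ℂ)))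
    (hψbad : ∀ (ℓ : ℕ) [Fact ℓ.Prime], ¬ W.HasGoodReductionAtPrime ℓ →
      ∀ w : HeightOneSpectrum (𝓞 L), (ℓ : 𝓞 L) ∈ w.asIdeal → ¬ (ψ.compRelNorm L).IsUnramifiedAt w)
    {f : CuspForm (Gamma0 (W.conductorNorm ℤ)) 2} (hf : IsNewformOf W f)
    (h2K₁ : Module.finrank ℚ K₁ = 2) (h2K : Module.finrank ℚ K = 2) (h2L : Module.finrank K L = 2)
    (h2L₁ : Module.finrank K₁ L = 2) {τ : L ≃ₐ[K] L} (hτ : τ ≠ 1) (hτc : (τ.restrictScalars ℚ).restrictNormal K₁ = c)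
    (θ₀ : 𝓞 K₁) (a : ℤ) (hcθ : c • θ₀ = (a : 𝓞 K₁) - θ₀)
    (hθ : ∀ 𝔮 : HeightOneSpectrum (𝓞 K₁), Ideal.absNorm 𝔮.asIdeal = (Ideal.absNorm 𝔮.asIdeal).minFac ^ 2 →
      (a : 𝓞 K₁) - 2 * θ₀ ∉ 𝔮.asIdeal)
    (hθram : ∀ (ℓ : ℕ) [Fact ℓ.Prime] (𝔮 : HeightOneSpectrum (𝓞 K₁)), (ℓ : 𝓞 K₁) ∈ 𝔮.asIdeal →
      (a : 𝓞 K₁) - 2 * θ₀ ∈ 𝔮.asIdeal → ¬ W.HasGoodReductionAtPrime ℓ)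
    {ν : HeckeCharacter L} (hν : ∀ x : ideleGroup L, ((ν x : ℂˣ) : ℂ) = ((ideleNorm x : ℝ) : ℂ) ^ (1 : ℂ))
    {κ_ : ℕ → InfinitePlace L → ℕ}
    (hT : ∀ (χ : HeckeCharacter K) (n : ℕ), 0 < n → (∀ v : HeightOneSpectrum (𝓞 K), χ.IsUnramifiedAt v) →
      χ.HasInfinityType (fun _ ↦ (n : ℤ)) (fun _ ↦ -(n : ℤ)) →
      KatzCM.HasKatzType ι Sp (ψ.compRelNorm L * ν * χ.compRelNorm L) 1 (κ_ n)) :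
    ∀ (χ : HeckeCharacter K) (n : ℕ), 0 < n → (∀ v : HeightOneSpectrum (𝓞 K), χ.IsUnramifiedAt v) →
      χ.HasInfinityType (fun _ ↦ (n : ℤ)) (fun _ ↦ -(n : ℤ)) →
      ∀ hL : LFunction.HasEntireContinuation (heckeLFunction (ψ.compRelNorm L * ν * χ.compRelNorm L)),
        hL.continuation 0 = 1 * 1 ^ n * rankinSelbergValueHecke f χ 1 :=
  hLval_of_deuring hSp W hCM c hψ1 hψgood hψbad hf h2K h2L hτ hτc
    (absNorm_eq_minFac_of_inertiaDeg_eq_two h2K₁ h2K h2L h2L₁ c hτ hτc θ₀ a hcθ hθ)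
    (fun ℓ _ w v hw hℓ he ↦ not_hasGoodReductionAtPrime_of_ramificationIdx_eq_two W h2L c hτ hτc θ₀ a hcθ hθram ℓ w v hw hℓ he)
    hν hT

end Summit.BirchSwinnertonDyer.BirchSwinnertonDyer.Theorems.BiquadraticEisensteinDescentEisensteinHeartFlatCMInertBadKPrimeKatzHsiehLValueCM

end
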